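import Summits.AtomisticToContinuum.FouriersLaw.Theorems.LocalOhmBVLocalOhmStubGibbsTermCovarianceDecayAux1
import Summits.AtomisticToContinuum.FouriersLaw.Theorems.HeatModeWeylLawSpecificHeatLimitPinned
import Summits.AtomisticToContinuum.FouriersLaw.Theorems.BondHeatUncertaintyLinearResponseFTURGridIncrements

/-!
# Per-term covariance decay for the free finite Gibbs state (stub `stub_gibbsTermCovarianceDecay`),
# helper IV: the symmetrised transfer data of the pinned chain on the one-site phase space `ℝ × ℝ`,
# and transport of phase-space Gibbs integrals to the product a priori measure

Helper file for crux item stmt-AtomisticToContinuum-12009 (`LocalOhmBV.LocalOhm`, line `registered`,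
stub T2 `stub_gibbsTermCovarianceDecay`). For `P = pinnedChain ω₂ lam β γ` (`ω₂ > 0`, `lam, β ≥ 0`) and
`T > 0`, with the one-site factor `a(q, p) = e^{-(p²/2 + U(q))/4T}`, the bond factor
`K₀ = e^{-V(q'-q)/T}`, the symmetrised kernel `k = a K₀ a`, the a priori measure `ρ = a² dq dp` on
`ℝ × ℝ` and the weight `w` of `…GibbsTermCovarianceDecayAux1` (all through defining hypotheses):

* `siteWeight_props₂`, `integrable_siteWeight_sq₂`, `isFiniteMeasure_siteMeasure₂`,
  `siteMeasure_ne_zero₂` — `a` is continuous, `0 < a ≤ 1`, `U a ≤ 4T`, `a² ∈ L¹`, `ρ` finite nonzero;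
* `transferKernel_props₂`, `insertion_bounds₂` — `K₀`, `k` continuous, symmetric, `0 < k ≤ 1`; the
  pinning and bond insertion kernels `k · U(q')`, `k · V(q'-q)` are bounded by `4T`, `T`
  (adapted from the position-space versions in `HeatModeWeylLawSpecificHeatLimitPinned`);
* `pi_siteMeasure_eq_withDensity` — `ρ^{⊗N} = (∏ a(ζᵢ)²) · Leb` (tree: `LinearResponseFTUR.pi_withDensity_fin`);
* `integral_mul_gibbsDensity_eq_integral_w`, `integrable_mul_w_of_integrable_mul_gibbsDensity` —
  **transport**: `∫ F e^{-H_N/T} dq dp = ∫ F(q, p) w_N(ζ) dρ^{⊗N}(ζ)` (`ζᵢ = (qᵢ, pᵢ)`; Mathlib's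
  volume-preserving `arrowProdEquivProdArrow`), with integrability carried along.

All [folklore]; no definitions.
-/

set_option autoImplicit false

noncomputable section

namespace Summit.AtomisticToContinuum.FouriersLaw.Theorems.LocalOhmBirth.TermDecay

open MeasureTheory Filter Topology Function
open scoped BigOperators ENNReal
open Literature.MathematicalPhysics.KineticTheory.HeatConduction
open Summit.AtomisticToContinuum.FouriersLaw.Theorems.SpecificHeatLimit

/-! ### The one-site factor `a` and the a priori measure `ρ = a² dq dp` -/

section Pinned

variable {ω₂ lam β γ T : ℝ} {a : ℝ × ℝ → ℝ} {K₀ k : ℝ × ℝ → ℝ × ℝ → ℝ}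

/-- **The one-site factor** `a(q, p) = e^{-(p²/2+U(q))/4T}`: continuous, measurable, `0 < a ≤ 1`,
and `U(q) a(q, p) ≤ 4T` (`T > 0`, `ω₂, lam ≥ 0`). -/
theorem siteWeight_props₂ (hω : 0 ≤ ω₂) (hl : 0 ≤ lam) (hT : 0 < T)
    (ha : ∀ z, a z = Real.exp (-(z.2 ^ 2 / 2 + (pinnedChain ω₂ lam β γ).U z.1) / (4 * T))) :
    Continuous a ∧ Measurable a ∧ (∀ z, 0 < a z) ∧ (∀ z, a z ≤ 1) ∧ (∀ z, ‖a z‖ ≤ 1) ∧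
      (∀ z, (pinnedChain ω₂ lam β γ).U z.1 * a z ≤ 4 * T) := by
  have hae : a = fun z : ℝ × ℝ => Real.exp (-(z.2 ^ 2 / 2 + (pinnedChain ω₂ lam β γ).U z.1) / (4 * T)) :=
    funext ha
  have hc : Continuous a := by
    rw [hae]
    refine Real.continuous_exp.comp ((((continuous_snd.pow 2).div_const _).add
      ((pinnedChain_continuous_U γ).comp continuous_fst)).neg.div_const _)
  have hU0 := pinnedChain_U_nonneg (β := β) hω hl γ
  have hpos : ∀ z, 0 < a z := fun z => by rw [ha]; exact Real.exp_pos _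
  have hle : ∀ z, a z ≤ 1 := fun z => by
    rw [ha, Real.exp_le_one_iff, neg_div]
    exact neg_nonpos.2 (div_nonneg (add_nonneg (by positivity) (hU0 z.1)) (by positivity))
  refine ⟨hc, hc.measurable, hpos, hle, fun z => ?_, fun z => ?_⟩
  · rw [Real.norm_of_nonneg (hpos z).le]; exact hle z
  · have h1 : a z ≤ Real.exp (-(pinnedChain ω₂ lam β γ).U z.1 / (4 * T)) := by
      rw [ha, Real.exp_le_exp, neg_div, neg_div, neg_le_neg_iff]
      exact div_le_div_of_nonneg_right (by nlinarith [sq_nonneg z.2]) (by positivity)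
    calc (pinnedChain ω₂ lam β γ).U z.1 * a z
        ≤ (pinnedChain ω₂ lam β γ).U z.1 * Real.exp (-(pinnedChain ω₂ lam β γ).U z.1 / (4 * T)) :=
          mul_le_mul_of_nonneg_left h1 (hU0 z.1)
      _ ≤ 4 * T := mul_exp_neg_div_le (by positivity)

/-- `a²` is integrable on `ℝ × ℝ` (domination by a product of Gaussians, `ω₂ > 0`). -/
theorem integrable_siteWeight_sq₂ (hω : 0 < ω₂) (hl : 0 ≤ lam) (hT : 0 < T)
    (ha : ∀ z, a z = Real.exp (-(z.2 ^ 2 / 2 + (pinnedChain ω₂ lam β γ).U z.1) / (4 * T))) :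
    Integrable fun z => a z ^ 2 := by
  obtain ⟨hac, -, hapos, -, -, -⟩ := siteWeight_props₂ (β := β) (γ := γ) hω.le hl hT ha
  have hq : Integrable fun q : ℝ => Real.exp (-(ω₂ / (4 * T)) * q ^ 2) :=
    integrable_exp_neg_mul_sq (by positivity)
  have hp : Integrable fun p : ℝ => Real.exp (-(1 / (4 * T)) * p ^ 2) :=
    integrable_exp_neg_mul_sq (by positivity)
  have hg : Integrable (fun z : ℝ × ℝ => Real.exp (-(ω₂ / (4 * T)) * z.1 ^ 2) *
      Real.exp (-(1 / (4 * T)) * z.2 ^ 2)) := by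
    have := hq.mul_prod hp
    simpa [Measure.volume_eq_prod] using this
  refine hg.mono (hac.pow 2).aestronglyMeasurable (Eventually.of_forall fun z => ?_)
  rw [Real.norm_of_nonneg (sq_nonneg _), Real.norm_of_nonneg (by positivity), ha,
    ← Real.exp_nat_mul, ← Real.exp_add, Real.exp_le_exp]
  push_cast
  have hU := pinnedChain_U_ge (ω₂ := ω₂) (β := β) hl γ z.1
  rw [show (2 : ℝ) * (-(z.2 ^ 2 / 2 + (pinnedChain ω₂ lam β γ).U z.1) / (4 * T)) =
    -((z.2 ^ 2 / 2 + (pinnedChain ω₂ lam β γ).U z.1) / (2 * T)) by field_simp; ring]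
  rw [show -(ω₂ / (4 * T)) * z.1 ^ 2 + -(1 / (4 * T)) * z.2 ^ 2 =
    -((z.2 ^ 2 / 2 + ω₂ * z.1 ^ 2 / 2) / (2 * T)) by field_simp; ring]
  exact neg_le_neg (div_le_div_of_nonneg_right (by linarith) (by positivity))

/-- **The a priori measure `ρ = a² dq dp` is finite.** -/
theorem isFiniteMeasure_siteMeasure₂ (hω : 0 < ω₂) (hl : 0 ≤ lam) (hT : 0 < T)
    (ha : ∀ z, a z = Real.exp (-(z.2 ^ 2 / 2 + (pinnedChain ω₂ lam β γ).U z.1) / (4 * T)))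
    {ρ : Measure (ℝ × ℝ)} (hρ : ρ = volume.withDensity fun z => ENNReal.ofReal (a z ^ 2)) :
    IsFiniteMeasure ρ := by
  rw [hρ]
  exact isFiniteMeasure_withDensity_ofReal (integrable_siteWeight_sq₂ hω hl hT ha).hasFiniteIntegral

/-- **The a priori measure is nonzero.** -/
theorem siteMeasure_ne_zero₂ (hω : 0 < ω₂) (hl : 0 ≤ lam) (hT : 0 < T)
    (ha : ∀ z, a z = Real.exp (-(z.2 ^ 2 / 2 + (pinnedChain ω₂ lam β γ).U z.1) / (4 * T)))
    {ρ : Measure (ℝ × ℝ)} (hρ : ρ = volume.withDensity fun z => ENNReal.ofReal (a z ^ 2)) : ρ ≠ 0 := by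
  obtain ⟨hac, -, hapos, -, -, -⟩ := siteWeight_props₂ (β := β) (γ := γ) hω.le hl hT ha
  intro h0
  have h1 : ρ Set.univ = 0 := by rw [h0]; rfl
  rw [hρ, withDensity_apply _ MeasurableSet.univ, Measure.restrict_univ,
    lintegral_eq_zero_iff (hac.measurable.pow_const 2).ennreal_ofReal] at h1
  have hcont : Continuous fun z : ℝ × ℝ => ENNReal.ofReal (a z ^ 2) :=
    ENNReal.continuous_ofReal.comp (hac.pow 2)
  have h2 : (fun z : ℝ × ℝ => ENNReal.ofReal (a z ^ 2)) = fun _ => (0 : ℝ≥0∞) :=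
    (Continuous.ae_eq_iff_eq volume hcont continuous_const).1 h1
  have h3 := congrFun h2 0
  simp only [ENNReal.ofReal_eq_zero] at h3
  exact absurd h3 (not_le.2 (pow_pos (hapos 0) 2))

/-- **The bond factor and the symmetrised kernel.** `K₀((q,p),(q',p')) = e^{-V(q'-q)/T}` is
continuous, symmetric (`V` even), `0 < K₀ ≤ 1` (`V ≥ 0`, `T > 0`); `k = a K₀ a` is continuous,
symmetric, strictly positive and bounded by `1`. -/
theorem transferKernel_props₂ (hω : 0 ≤ ω₂) (hl : 0 ≤ lam) (hβ : 0 ≤ β) (hT : 0 < T)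
    (ha : ∀ z, a z = Real.exp (-(z.2 ^ 2 / 2 + (pinnedChain ω₂ lam β γ).U z.1) / (4 * T)))
    (hK₀ : ∀ z z', K₀ z z' = Real.exp (-(pinnedChain ω₂ lam β γ).V (z'.1 - z.1) / T))
    (hk : ∀ z z', k z z' = a z * K₀ z z' * a z') :
    Continuous (uncurry K₀) ∧ (∀ z z', 0 < K₀ z z') ∧ (∀ z z', 0 ≤ K₀ z z') ∧ (∀ z z', K₀ z z' ≤ 1) ∧
      (∀ z z', K₀ z z' = K₀ z' z) ∧
    Continuous (uncurry k) ∧ (∀ z z', k z z' = k z' z) ∧ (∀ z z', 0 < k z z') ∧ (∀ z z', ‖k z z'‖ ≤ 1) := by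
  obtain ⟨hac, -, hapos, hale, -, -⟩ := siteWeight_props₂ (β := β) (γ := γ) hω hl hT ha
  have hK₀e : uncurry K₀ = fun p : (ℝ × ℝ) × (ℝ × ℝ) =>
      Real.exp (-(pinnedChain ω₂ lam β γ).V (p.2.1 - p.1.1) / T) := funext fun p => hK₀ p.1 p.2
  have hK₀c : Continuous (uncurry K₀) := by
    rw [hK₀e]
    exact Real.continuous_exp.comp ((((pinnedChain_continuous_V γ).comp
      ((continuous_fst.comp continuous_snd).sub (continuous_fst.comp continuous_fst))).neg).div_const _)
  have hK₀pos : ∀ z z', 0 < K₀ z z' := fun z z' => by rw [hK₀]; exact Real.exp_pos _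
  have hK₀le : ∀ z z', K₀ z z' ≤ 1 := fun z z' => by
    rw [hK₀, Real.exp_le_one_iff, neg_div]
    exact neg_nonpos.2 (div_nonneg (pinnedChain_V_nonneg hβ γ _) hT.le)
  have hK₀symm : ∀ z z', K₀ z z' = K₀ z' z := fun z z' => by
    rw [hK₀, hK₀, show z.1 - z'.1 = -(z'.1 - z.1) by ring, pinnedChain_V_neg]
  have hke : uncurry k = fun p : (ℝ × ℝ) × (ℝ × ℝ) => a p.1 * uncurry K₀ p * a p.2 :=
    funext fun p => hk p.1 p.2
  have hkc : Continuous (uncurry k) := by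
    rw [hke]
    exact ((hac.comp continuous_fst).mul hK₀c).mul (hac.comp continuous_snd)
  have hkpos : ∀ z z', 0 < k z z' := fun z z' => by
    rw [hk]; exact mul_pos (mul_pos (hapos z) (hK₀pos z z')) (hapos z')
  have hkle : ∀ z z', k z z' ≤ 1 := fun z z' => by
    rw [hk]
    calc a z * K₀ z z' * a z' ≤ 1 * 1 * 1 :=
          mul_le_mul (mul_le_mul (hale z) (hK₀le z z') (hK₀pos z z').le zero_le_one) (hale z')
            (hapos z').le (by norm_num)
      _ = 1 := by ring
  refine ⟨hK₀c, hK₀pos, fun z z' => (hK₀pos z z').le, hK₀le, hK₀symm, hkc, fun z z' => ?_, hkpos,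
    fun z z' => ?_⟩
  · rw [hk, hk, hK₀symm]; ring
  · rw [Real.norm_of_nonneg (hkpos z z').le]; exact hkle z z'

/-- **The insertion kernels are bounded.** The pinning insertion `k(z, z') U(q')` is bounded by
`4T`, the bond insertion `k(z, z') V(q' - q)` by `T`; both are continuous. -/
theorem insertion_bounds₂ (hω : 0 ≤ ω₂) (hl : 0 ≤ lam) (hβ : 0 ≤ β) (hT : 0 < T)
    (ha : ∀ z, a z = Real.exp (-(z.2 ^ 2 / 2 + (pinnedChain ω₂ lam β γ).U z.1) / (4 * T)))
    (hK₀ : ∀ z z', K₀ z z' = Real.exp (-(pinnedChain ω₂ lam β γ).V (z'.1 - z.1) / T))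
    (hk : ∀ z z', k z z' = a z * K₀ z z' * a z') :
    Continuous (uncurry fun z z' => k z z' * (pinnedChain ω₂ lam β γ).U z'.1) ∧
      (∀ z z', ‖k z z' * (pinnedChain ω₂ lam β γ).U z'.1‖ ≤ 4 * T) ∧
    Continuous (uncurry fun z z' => k z z' * (pinnedChain ω₂ lam β γ).V (z'.1 - z.1)) ∧
      (∀ z z', ‖k z z' * (pinnedChain ω₂ lam β γ).V (z'.1 - z.1)‖ ≤ T) := by
  set P := pinnedChain ω₂ lam β γ with hP
  obtain ⟨hac, -, hapos, hale, -, hUa⟩ := siteWeight_props₂ (β := β) (γ := γ) hω hl hT ha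
  obtain ⟨hK₀c, hK₀pos, -, hK₀le, -, hkc, -, hkpos, -⟩ := transferKernel_props₂ hω hl hβ hT ha hK₀ hk
  have hU0 := pinnedChain_U_nonneg (β := β) hω hl γ
  have hV0 := pinnedChain_V_nonneg (ω₂ := ω₂) (lam := lam) hβ γ
  refine ⟨?_, fun z z' => ?_, ?_, fun z z' => ?_⟩
  · exact hkc.mul ((pinnedChain_continuous_U γ).comp (continuous_fst.comp continuous_snd))
  · rw [Real.norm_of_nonneg (mul_nonneg (hkpos z z').le (hU0 _)), hk]
    calc a z * K₀ z z' * a z' * P.U z'.1 = (a z * K₀ z z') * (P.U z'.1 * a z') := by ring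
      _ ≤ 1 * (4 * T) := by
          refine mul_le_mul ?_ (hUa z') (mul_nonneg (hU0 _) (hapos z').le) zero_le_one
          exact mul_le_one₀ (hale z) (hK₀pos z z').le (hK₀le z z')
      _ = 4 * T := one_mul _
  · exact hkc.mul ((pinnedChain_continuous_V γ).comp
      ((continuous_fst.comp continuous_snd).sub (continuous_fst.comp continuous_fst)))
  · rw [Real.norm_of_nonneg (mul_nonneg (hkpos z z').le (hV0 _)), hk, hK₀]
    have hVk : P.V (z'.1 - z.1) * Real.exp (-P.V (z'.1 - z.1) / T) ≤ T := mul_exp_neg_div_le hT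
    calc a z * Real.exp (-P.V (z'.1 - z.1) / T) * a z' * P.V (z'.1 - z.1)
        = (a z * a z') * (P.V (z'.1 - z.1) * Real.exp (-P.V (z'.1 - z.1) / T)) := by ring
      _ ≤ 1 * T := by
          refine mul_le_mul (mul_le_one₀ (hale z) (hapos z').le (hale z')) hVk
            (mul_nonneg (hV0 _) (Real.exp_pos _).le) zero_le_one
      _ = T := one_mul _

end Pinned

/-! ### Transport of phase-space integrals to the product a priori measure -/

section Transport

variable (P : OscillatorChain) {T : ℝ} {a : ℝ × ℝ → ℝ} {K₀ : ℝ × ℝ → ℝ × ℝ → ℝ}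
  {w : (N : ℕ) → (Fin N → ℝ × ℝ) → ℝ} {ρ : Measure (ℝ × ℝ)}

/-- **`ρ^{⊗N}` is Lebesgue measure on `(ℝ × ℝ)^N` with density `∏ a(ζᵢ)²`.** -/
theorem pi_siteMeasure_eq_withDensity (ham : Measurable a)
    (hρ : ρ = volume.withDensity fun z => ENNReal.ofReal (a z ^ 2)) (N : ℕ) :
    Measure.pi (fun _ : Fin N => ρ) =
      (volume : Measure (Fin N → ℝ × ℝ)).withDensity fun ζ => ENNReal.ofReal (∏ i, a (ζ i) ^ 2) := by
  rw [hρ, Summit.AtomisticToContinuum.FouriersLaw.Theorems.LinearResponseFTUR.pi_withDensity_fin volume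
    ((ham.pow_const 2).ennreal_ofReal) N, volume_pi]
  congr 1
  funext ζ
  exact (ENNReal.ofReal_prod_of_nonneg fun i _ => sq_nonneg _).symm

/-- **Transport of Gibbs-type phase-space integrals.** With `a = e^{-(p²/2+U(q))/4T}`,
`K₀ = e^{-V(q'-q)/T}`, `ρ = a² dq dp` and the weight `w`:
`∫ F(x) e^{-H_N(x)/T} dx = ∫ F(q(ζ), p(ζ)) w_N(ζ) dρ^{⊗N}(ζ)` for every `F`, where `ζᵢ = (qᵢ, pᵢ)`. -/
theorem integral_mul_gibbsDensity_eq_integral_w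
    (ha : ∀ z, a z = Real.exp (-(z.2 ^ 2 / 2 + P.U z.1) / (4 * T)))
    (hK₀ : ∀ z z', K₀ z z' = Real.exp (-P.V (z'.1 - z.1) / T))
    (hw : ∀ (N : ℕ) (ζ : Fin N → ℝ × ℝ), w N ζ = (∏ i, a (ζ i) ^ 2) *
      ∏ i : Fin N, ∏ j : Fin N, if j.val = i.val + 1 then K₀ (ζ i) (ζ j) else 1)
    (ham : Measurable a)
    (hρ : ρ = volume.withDensity fun z => ENNReal.ofReal (a z ^ 2)) (N : ℕ) (F : PhaseSpace N → ℝ) :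
    ∫ x, F x * P.gibbsDensity N T x =
      ∫ ζ, F ((fun i => (ζ i).1), (fun i => (ζ i).2)) * w N ζ ∂(Measure.pi fun _ : Fin N => ρ) := by
  have hmp := volume_measurePreserving_arrowProdEquivProdArrow ℝ ℝ (Fin N)
  have hD : Measurable fun ζ : Fin N → ℝ × ℝ => ENNReal.ofReal (∏ i, a (ζ i) ^ 2) :=
    (Finset.measurable_prod _ fun i _ => (ham.comp (measurable_pi_apply i)).pow_const 2).ennreal_ofReal
  rw [pi_siteMeasure_eq_withDensity ham hρ N,
    integral_withDensity_eq_integral_toReal_smul hD (Eventually.of_forall fun _ => ENNReal.ofReal_lt_top),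
    ← hmp.integral_comp']
  refine integral_congr_ae (ae_of_all _ fun ζ => ?_)
  dsimp only
  rw [ENNReal.toReal_ofReal (Finset.prod_nonneg fun i _ => sq_nonneg _), smul_eq_mul]
  have he : (MeasurableEquiv.arrowProdEquivProdArrow ℝ ℝ (Fin N)) ζ =
      ((fun i => (ζ i).1), (fun i => (ζ i).2)) := rfl
  rw [he, gibbsDensity_unzip_eq P T ha hK₀ hw N ζ]
  ring

/-- **Transport of integrability.** If `F e^{-H_N/T}` is Lebesgue integrable on phase space then
`F(q(ζ), p(ζ)) w_N(ζ)` is `ρ^{⊗N}`-integrable. -/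
theorem integrable_mul_w_of_integrable_mul_gibbsDensity
    (ha : ∀ z, a z = Real.exp (-(z.2 ^ 2 / 2 + P.U z.1) / (4 * T)))
    (hK₀ : ∀ z z', K₀ z z' = Real.exp (-P.V (z'.1 - z.1) / T))
    (hw : ∀ (N : ℕ) (ζ : Fin N → ℝ × ℝ), w N ζ = (∏ i, a (ζ i) ^ 2) *
      ∏ i : Fin N, ∏ j : Fin N, if j.val = i.val + 1 then K₀ (ζ i) (ζ j) else 1)
    (ham : Measurable a)
    (hρ : ρ = volume.withDensity fun z => ENNReal.ofReal (a z ^ 2)) (N : ℕ) {F : PhaseSpace N → ℝ}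
    (hFi : Integrable fun x => F x * P.gibbsDensity N T x) :
    Integrable (fun ζ => F ((fun i => (ζ i).1), (fun i => (ζ i).2)) * w N ζ)
      (Measure.pi fun _ : Fin N => ρ) := by
  have hmp := volume_measurePreserving_arrowProdEquivProdArrow ℝ ℝ (Fin N)
  have hD : Measurable fun ζ : Fin N → ℝ × ℝ => ENNReal.ofReal (∏ i, a (ζ i) ^ 2) :=
    (Finset.measurable_prod _ fun i _ => (ham.comp (measurable_pi_apply i)).pow_const 2).ennreal_ofReal
  rw [pi_siteMeasure_eq_withDensity ham hρ N,
    integrable_withDensity_iff_integrable_smul' hD (Eventually.of_forall fun _ => ENNReal.ofReal_lt_top)]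
  have h1 : Integrable ((fun x => F x * P.gibbsDensity N T x) ∘
      (MeasurableEquiv.arrowProdEquivProdArrow ℝ ℝ (Fin N))) volume :=
    (hmp.integrable_comp_emb (MeasurableEquiv.arrowProdEquivProdArrow ℝ ℝ (Fin N)).measurableEmbedding).2 hFi
  refine h1.congr (ae_of_all _ fun ζ => ?_)
  rw [Function.comp_apply]
  dsimp only
  rw [ENNReal.toReal_ofReal (Finset.prod_nonneg fun i _ => sq_nonneg _), smul_eq_mul]
  have he : (MeasurableEquiv.arrowProdEquivProdArrow ℝ ℝ (Fin N)) ζ =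
      ((fun i => (ζ i).1), (fun i => (ζ i).2)) := rfl
  rw [he, gibbsDensity_unzip_eq P T ha hK₀ hw N ζ]
  ring

/-- **The partition function and the weight**: `∫ e^{-H_N/T} dx = ∫ w_N dρ^{⊗N}`, and `w_N` is
`ρ^{⊗N}`-integrable as soon as `e^{-H_N/T}` is Lebesgue integrable. -/
theorem integral_gibbsDensity_eq_integral_w
    (ha : ∀ z, a z = Real.exp (-(z.2 ^ 2 / 2 + P.U z.1) / (4 * T)))
    (hK₀ : ∀ z z', K₀ z z' = Real.exp (-P.V (z'.1 - z.1) / T))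
    (hw : ∀ (N : ℕ) (ζ : Fin N → ℝ × ℝ), w N ζ = (∏ i, a (ζ i) ^ 2) *
      ∏ i : Fin N, ∏ j : Fin N, if j.val = i.val + 1 then K₀ (ζ i) (ζ j) else 1)
    (ham : Measurable a)
    (hρ : ρ = volume.withDensity fun z => ENNReal.ofReal (a z ^ 2)) (N : ℕ)
    (hint : Integrable (P.gibbsDensity N T)) :
    ∫ x, P.gibbsDensity N T x = ∫ ζ, w N ζ ∂(Measure.pi fun _ : Fin N => ρ) ∧
      Integrable (w N) (Measure.pi fun _ : Fin N => ρ) := by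
  have h1 := integral_mul_gibbsDensity_eq_integral_w P ha hK₀ hw ham hρ N (fun _ => 1)
  have h2 := integrable_mul_w_of_integrable_mul_gibbsDensity P ha hK₀ hw ham hρ N
    (F := fun _ => 1) (by simpa using hint)
  simp only [one_mul] at h1 h2
  exact ⟨h1, h2⟩

end Transport


/-- **Headline (registered helper stub).** Transport of Gibbs-type phase-space integrals of an
oscillator chain to the product of the symmetrised one-site a priori measures: with
`a = e^{-(p²/2+U(q))/4T}`, `K₀ = e^{-V(q'-q)/T}`, the weight `w` and `ρ = a² dq dp`,
`∫ F(x) e^{-H_N(x)/T} dx = ∫ F(q(ζ), p(ζ)) w_N(ζ) dρ^{⊗N}(ζ)` for every `F` and `N`. -/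
theorem gibbs_integral_transport :
    ∀ (P : OscillatorChain) (T : ℝ) (a : ℝ × ℝ → ℝ) (K₀ : ℝ × ℝ → ℝ × ℝ → ℝ)
      (w : (N : ℕ) → (Fin N → ℝ × ℝ) → ℝ) (ρ : Measure (ℝ × ℝ)),
      (∀ z, a z = Real.exp (-(z.2 ^ 2 / 2 + P.U z.1) / (4 * T))) →
      (∀ z z', K₀ z z' = Real.exp (-P.V (z'.1 - z.1) / T)) →
      (∀ (N : ℕ) (ζ : Fin N → ℝ × ℝ), w N ζ = (∏ i, a (ζ i) ^ 2) *
        ∏ i : Fin N, ∏ j : Fin N, if j.val = i.val + 1 then K₀ (ζ i) (ζ j) else 1) →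
      Measurable a → ρ = volume.withDensity (fun z => ENNReal.ofReal (a z ^ 2)) →
      ∀ (N : ℕ) (F : PhaseSpace N → ℝ),
        ∫ x, F x * P.gibbsDensity N T x =
          ∫ ζ, F ((fun i => (ζ i).1), (fun i => (ζ i).2)) * w N ζ ∂(Measure.pi fun _ : Fin N => ρ) := by
  intro P T a K₀ w ρ ha hK₀ hw ham hρ N F
  exact integral_mul_gibbsDensity_eq_integral_w P ha hK₀ hw ham hρ N F

end Summit.AtomisticToContinuum.FouriersLaw.Theorems.LocalOhmBirth.TermDecay

end
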